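import Literature.MathematicalPhysics.QuantumFieldTheory.Balaban1983to89.B11SectGGlobalSizes

/-!
# `Balaban1983to89.B11SectGSmoothCut` — the generic SMOOTH-PARTITION block norm: a `B11SectG.BlockNorm` whose cut-offs are the multiplications by a
# partition of unity `ζ_y` (not sharp restrictions), whose local size is the jump-free `W(y)·sup_{Δ̃(y)}|f| + sup_pairs w·|f x − f x′|`, and whose cutting
# cost is `κ = 1 + Λ`, `Λ` the scale-covariant Lipschitz constant of `ζ` (`w·|Δζ_y| ≤ Λ·W(y)`) — the class in which a HÖLDER-type intermediate is produced, consumed and cut member-uniformly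

[4] = T. Bałaban, *Propagators and renormalization transformations for lattice gauge theories. II*, Commun. Math. Phys. **96** (1984) 223–250
[`Balaban1984PropagatorsII`]; [B9] = T. Bałaban, *Propagators for lattice gauge theories in a background field*, Commun. Math. Phys. **99** (1985) 389–434
[`Balaban1985BackgroundPropagators`]; [B11] = T. Bałaban, *The variational problem and background fields in renormalization group method for lattice gauge
theories*, Commun. Math. Phys. **102** (1985) 277–309 [`Balaban1985Variational`].

statement-level skeleton of published theorems with citation tags; proofs where landed; nothing here is a claim about the
Yang–Mills mass gap

THE PRINTED LOCI.  [4] (2.51)–(2.52) p. 232: block majorants and *"Σ_y Δ(y) = I"*; [B9] (3.43)–(3.45) p. 398: the Hölder entries are localised on the output side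
by *"ζ ∈ C₀^∞(Δ̃(y))"* with the cost *"(‖ζ‖^ξ_α + |ζ|)"* and on the input side by *"supp λ ⊂ Δ̃(y′)"* with the size *"(‖λ‖_{α+ε} + |λ|)"*; [B11] (189)–(190)
p. 308: *"for supp 𝔄 ⊂ Δ̃(y′) … for x ∈ Δ(y), or supp ζ ⊂ Δ̃(y)"* — the C¹∕Hölder-type sizes of Sect. G are cut by a SMOOTH partition subordinate to the enlarged
blocks (`B11SectG.BlockNorm`'s docstring: *"for the C¹-type sizes a smooth partition subordinate to the enlarged blocks Δ̃(y)"*, cost `κ`).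

WHY THIS FILE (cell `pub-ymgap`, node N06, width seat `pub-ymgap-dag-n06-w6` g2; the located architecture item of the N06 certificate, dag-n06-l g19 CLOSE
«`bXH x` must be an (F1) SMOOTH-PARTITION class — `BlockNorm` with `cut y := ζ_y ·`, |∇ζ| ≲ (Lʲη)⁻¹, `IsLoc y :=` support near Δ(y), κ = O(1) — expressible in
the existing `BlockNorm` signature»; the seat's `BH13-PIN-MEMO` (F1)).  A sharp restriction of a Hölder-sized vector jumps at the class boundary
(`B9CoReadingCoordsInputJump`); a smooth cut does not.  GENERIC KERNEL PIECE over ANY finite carrier `X`: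
* §1 ★★ `BlockNorm.ofSmoothPartition` — DATA: neighbourhoods `N : 𝔅 → X → Prop` (the enlarged blocks), a pair domain `P` with weight `w ≥ 0`, sup weights
  `W(y) ≥ 0` (the powers (Lʲη)^{−p}), a PARTITION OF UNITY `ζ : 𝔅 → X → ℝ` (`Σ_y ζ y x = 1`, `0 ≤ ζ ≤ 1`, `ζ y` vanishes off `N y`) with the SCALE-COVARIANT
  Lipschitz bound `w x x′·|ζ y x − ζ y x′| ≤ Λ·W(y)` for `x ∈ N y`, `P x x′` (dag-n06-l's form: one datum serves the η- and the ξ-scale weights); NORM: `loc y := (Size.supPairs g N P w W).sz y` (jump-free), `cut y f := ζ_y·f`, `IsLoc y f :=`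
  `f` vanishes off `N y`, `κ := 1 + Λ`; the seven `BlockNorm` laws PROVED — `loc_cut_le` by the product rule
  `ζz·fz − ζz′·fz′ = (ζz − ζz′)·fz + ζz′·(fz − fz′)`;
* §2 `ofSmoothPartition_loc ∕ _cut_apply ∕ _isLoc_iff ∕ _κ ∕ _toSize_sz` (its size family IS `Size.supPairs`: the (F1) class and the global currency of
  `B11SectGGlobal` coincide); ★ `hasMaj_into_ofSmoothPartition` (a LOCALIZED majorant INTO the class from pointwise + pairwise output bounds on `N y` — print's
  (3.43)∕(3.45) output shape) and `hasMaj_from_ofSmoothPartition_iff` (a majorant OUT of it reads inputs vanishing off `N y′` with size `W·|λ|_{N y′} + ‖λ‖` —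
  print's (3.44)∕(3.45) input shape).
NOT IN THIS FILE: the partition of unity itself on a concrete multiscale carrier (the schema∕instance owners' datum; one-scale precedent in tree:
`B9Eq343BlockPartitionOfUnity.blockPartition` with `sum_blockProfile`, `blockProfile_nonneg ∕ _le_one`, `abs_blockProfile_sub_le`).
HONEST SCOPE.  Generic finite-dimensional bookkeeping; nothing of [4], [B9], [B11] asserted; no pin, no schema; COUNT-NEUTRAL; N06 NOT discharged; nothing
continuum, nothing about the mass gap.  Cell `pub-ymgap` (HUMAN RULING D-0062), Track A node N06 [B9], width seat `pub-ymgap-dag-n06-w6` (g2), 2026-08-28.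
-/

noncomputable section

namespace Literature.MathematicalPhysics.QuantumFieldTheory.Balaban1983to89.B11SectGSmoothCut

open Finset B6RandomWalk
open B11SectG (BlockNorm HasMaj)
open B11SectGGlobal (Size HasMajG)
open B11SectGGlobalSizes

variable {g : B6.Geometry} {X : Type} [Fintype X]

/-! ## §1 The smooth-partition block norm -/

/-- multiplication by the `y`-piece `ζ_y` of a partition of unity, as a linear map (the SMOOTH cut-off). [cite: Balaban1985BackgroundPropagators, (3.43) p.398 («ζ ∈ C₀^∞(Δ̃(y))»), dictionary] -/
def mulCut (ζ : g.Site → X → ℝ) (y : g.Site) : (X → ℝ) →ₗ[ℝ] (X → ℝ) where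
  toFun f x := ζ y x * f x
  map_add' f f' := by funext x; simp [mul_add]
  map_smul' r f := by funext x; simp [mul_left_comm]

omit [Fintype X] in
/-- `mulCut ζ y f x = ζ y x · f x`. [cite: Balaban1985BackgroundPropagators, (3.43) p.398, dictionary] -/
@[simp] theorem mulCut_apply (ζ : g.Site → X → ℝ) (y : g.Site) (f : X → ℝ) (x : X) : mulCut ζ y f x = ζ y x * f x := rfl

section Construction

variable (N : g.Site → X → Prop) [∀ y x, Decidable (N y x)] (P : X → X → Prop) [DecidableRel P] (w : X → X → ℝ) (hw : ∀ z z', 0 ≤ w z z')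
  (W : g.Site → ℝ) (hW : ∀ y, 0 ≤ W y) (ζ : g.Site → X → ℝ) (Λ : ℝ)

/-- ★★ **THE SMOOTH-PARTITION BLOCK NORM**: local size `W(y)·sup_{N y}|f| + ⨆ {w x x′·|f x − f x′| : x ∈ N y, P x x′}` read on the UNRESTRICTED vector, cut-offs
`ζ_y·` from a partition of unity subordinate to the neighbourhoods (`Σ_y ζ_y = 1`, `0 ≤ ζ ≤ 1`, `supp ζ_y ⊂ N y`) with the scale-covariant Lipschitz bound
`w·|ζ_y x − ζ_y x′| ≤ Λ·W(y)` (base point `x ∈ N y`, any `P`-partner `x′`) — localisation `supp f ⊂ N y`, cutting cost `κ = 1 + Λ`.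
[cite: Balaban1984PropagatorsII, (2.51)–(2.52) p.232; Balaban1985BackgroundPropagators, (3.43)–(3.45) p.398; Balaban1985Variational, (189)–(190) p.308] -/
def _root_.Literature.MathematicalPhysics.QuantumFieldTheory.Balaban1983to89.B11SectG.BlockNorm.ofSmoothPartition (hΛ : 0 ≤ Λ) (hsum : ∀ x, ∑ y : g.Site, ζ y x = 1) (h0 : ∀ y x, 0 ≤ ζ y x) (h1 : ∀ y x, ζ y x ≤ 1)
    (hsupp : ∀ y x, ¬ N y x → ζ y x = 0) (hLip : ∀ y x x', N y x → P x x' → w x x' * |ζ y x - ζ y x'| ≤ Λ * W y) : BlockNorm g (X → ℝ) where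
  loc := (Size.supPairs g (fun x y => N y x) P w hw W hW).sz
  cut y := mulCut ζ y
  IsLoc y f := ∀ x, ¬ N y x → f x = 0
  κ := 1 + Λ
  κ_nonneg := add_nonneg zero_le_one hΛ
  loc_nonneg := (Size.supPairs g (fun x y => N y x) P w hw W hW).nonneg
  loc_zero := (Size.supPairs g (fun x y => N y x) P w hw W hW).zero
  loc_add_le := (Size.supPairs g (fun x y => N y x) P w hw W hW).add_le
  loc_neg := (Size.supPairs g (fun x y => N y x) P w hw W hW).neg
  sum_cut f := by
    funext x
    rw [Finset.sum_apply]
    simp only [mulCut_apply]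
    rw [← Finset.sum_mul, hsum x, one_mul]
  isLoc_cut y f x hx := by rw [mulCut_apply, hsupp y x hx, zero_mul]
  loc_cut_le y f := by
    have hS0 : 0 ≤ (Size.ofSup g (fun x y => N y x)).sz y f := Size.nonneg _ _ _
    have hH0 : 0 ≤ (Size.ofPairs g (fun x y => N y x) P w hw).sz y f := Size.nonneg _ _ _
    have hSζ : (Size.ofSup g (fun x y => N y x)).sz y (mulCut ζ y f) ≤ (Size.ofSup g (fun x y => N y x)).sz y f := by
      refine ofSup_sz_le _ hS0 fun x hx => ?_
      rw [mulCut_apply, abs_mul, abs_of_nonneg (h0 y x)]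
      exact (mul_le_of_le_one_left (abs_nonneg _) (h1 y x)).trans (ofSup_abs_le _ hx f)
    have hW0 : 0 ≤ W y := hW y
    have hHζ : (Size.ofPairs g (fun x y => N y x) P w hw).sz y (mulCut ζ y f) ≤
        Λ * W y * (Size.ofSup g (fun x y => N y x)).sz y f + (Size.ofPairs g (fun x y => N y x) P w hw).sz y f := by
      refine ofPairs_sz_le _ _ _ _ (add_nonneg (mul_nonneg (mul_nonneg hΛ hW0) hS0) hH0) fun z z' hz hP => ?_
      rw [mulCut_apply, mulCut_apply]
      have hsplit : ζ y z * f z - ζ y z' * f z' = (ζ y z - ζ y z') * f z + ζ y z' * (f z - f z') := by ring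
      rw [hsplit]
      calc w z z' * |(ζ y z - ζ y z') * f z + ζ y z' * (f z - f z')|
          ≤ w z z' * (|ζ y z - ζ y z'| * |f z| + ζ y z' * |f z - f z'|) := by
            refine mul_le_mul_of_nonneg_left ?_ (hw z z')
            calc _ ≤ |(ζ y z - ζ y z') * f z| + |ζ y z' * (f z - f z')| := abs_add_le _ _
              _ = _ := by rw [abs_mul, abs_mul, abs_of_nonneg (h0 y z')]
        _ = (w z z' * |ζ y z - ζ y z'|) * |f z| + ζ y z' * (w z z' * |f z - f z'|) := by ring
        _ ≤ Λ * W y * (Size.ofSup g (fun x y => N y x)).sz y f + 1 * (Size.ofPairs g (fun x y => N y x) P w hw).sz y f :=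
            add_le_add (mul_le_mul (hLip y z z' hz hP) (ofSup_abs_le _ hz f) (abs_nonneg _) (mul_nonneg hΛ hW0))
              (mul_le_mul (h1 y z') (ofPairs_term_le _ _ _ _ hz hP f) (mul_nonneg (hw _ _) (abs_nonneg _)) zero_le_one)
        _ = _ := by rw [one_mul]
    show W y * (Size.ofSup g (fun x y => N y x)).sz y (mulCut ζ y f) + (Size.ofPairs g (fun x y => N y x) P w hw).sz y (mulCut ζ y f) ≤
        (1 + Λ) * (W y * (Size.ofSup g (fun x y => N y x)).sz y f + (Size.ofPairs g (fun x y => N y x) P w hw).sz y f)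
    have hΛH : 0 ≤ Λ * (Size.ofPairs g (fun x y => N y x) P w hw).sz y f := mul_nonneg hΛ hH0
    calc W y * (Size.ofSup g (fun x y => N y x)).sz y (mulCut ζ y f) + (Size.ofPairs g (fun x y => N y x) P w hw).sz y (mulCut ζ y f)
        ≤ W y * (Size.ofSup g (fun x y => N y x)).sz y f +
            (Λ * W y * (Size.ofSup g (fun x y => N y x)).sz y f + (Size.ofPairs g (fun x y => N y x) P w hw).sz y f) :=
          add_le_add (mul_le_mul_of_nonneg_left hSζ hW0) hHζ
      _ ≤ _ := by nlinarith [hΛH]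

/-! ## §2 Reading the construction -/

variable {N P w W ζ Λ} {hw} {hW}
variable {hΛ : 0 ≤ Λ} {hsum : ∀ x, ∑ y : g.Site, ζ y x = 1} {h0 : ∀ y x, 0 ≤ ζ y x} {h1 : ∀ y x, ζ y x ≤ 1}
  {hsupp : ∀ y x, ¬ N y x → ζ y x = 0} {hLip : ∀ y x x', N y x → P x x' → w x x' * |ζ y x - ζ y x'| ≤ Λ * W y}

/-- the local size is `W(y)·(sup over N y) + (pair part)`, read on the unrestricted vector. [cite: Balaban1985BackgroundPropagators, (3.39)–(3.40) p.397 + (3.44) p.398, bookkeeping] -/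
theorem ofSmoothPartition_loc (y : g.Site) (f : X → ℝ) :
    (BlockNorm.ofSmoothPartition N P w hw W hW ζ Λ hΛ hsum h0 h1 hsupp hLip).loc y f =
      W y * (Size.ofSup g (fun x y => N y x)).sz y f + (Size.ofPairs g (fun x y => N y x) P w hw).sz y f := rfl

/-- its size family IS the global currency's `Size.supPairs` (the (F1) class and the (F2) currency coincide). [cite: Balaban1984PropagatorsII, (2.51)–(2.53) p.232, bookkeeping] -/
theorem ofSmoothPartition_toSize_sz (y : g.Site) (f : X → ℝ) :
    (BlockNorm.ofSmoothPartition N P w hw W hW ζ Λ hΛ hsum h0 h1 hsupp hLip).toSize.sz y f =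
      (Size.supPairs g (fun x y => N y x) P w hw W hW).sz y f := rfl

/-- the cut-off is the multiplication by `ζ_y`. [cite: Balaban1985BackgroundPropagators, (3.43) p.398, bookkeeping] -/
theorem ofSmoothPartition_cut_apply (y : g.Site) (f : X → ℝ) (x : X) :
    (BlockNorm.ofSmoothPartition N P w hw W hW ζ Λ hΛ hsum h0 h1 hsupp hLip).cut y f x = ζ y x * f x := rfl

/-- localisation = support in the neighbourhood `N y` (print's «supp λ ⊂ Δ̃(y′)»). [cite: Balaban1985BackgroundPropagators, (3.44) p.398, bookkeeping] -/
theorem ofSmoothPartition_isLoc_iff (y : g.Site) (f : X → ℝ) :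
    (BlockNorm.ofSmoothPartition N P w hw W hW ζ Λ hΛ hsum h0 h1 hsupp hLip).IsLoc y f ↔ ∀ x, ¬ N y x → f x = 0 := Iff.rfl

/-- the cutting cost is `1 + Λ` — member-uniform as soon as `Λ` is. [cite: Balaban1984PropagatorsII, (2.52) p.232, bookkeeping] -/
theorem ofSmoothPartition_κ : (BlockNorm.ofSmoothPartition N P w hw W hW ζ Λ hΛ hsum h0 h1 hsupp hLip).κ = 1 + Λ := rfl

variable {F₁ F₂ : Type} [AddCommGroup F₁] [Module ℝ F₁] [AddCommGroup F₂] [Module ℝ F₂]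

/-- ★ **A LOCALIZED MAJORANT INTO THE SMOOTH-PARTITION CLASS FROM POINTWISE + PAIRWISE OUTPUT BOUNDS** (the shape of print's (3.43)∕(3.45) output side): if for
every input `μ` localized at `y′` in `b₁` the output obeys `|(T μ)(x)| ≤ K₀(y,y′)·loc_{y′} μ` on `N y` and `w(x,x′)·|(T μ)(x) − (T μ)(x′)| ≤ K₁(y,y′)·loc_{y′} μ` on
the pairs based in `N y` (`K₀, K₁ ≥ 0`), then `T` has the majorant `W(y)·K₀ + K₁` into the class. [cite: Balaban1985BackgroundPropagators, (3.43)–(3.45) p.398; Balaban1984PropagatorsII, (2.51) p.232] -/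
theorem hasMaj_into_ofSmoothPartition {b₁ : BlockNorm g F₁} {T : F₁ →ₗ[ℝ] (X → ℝ)} {K₀ K₁ : g.Site → g.Site → ℝ}
    (hK₀ : ∀ a b, 0 ≤ K₀ a b) (hK₁ : ∀ a b, 0 ≤ K₁ a b)
    (hpt : ∀ (y' : g.Site) (μ : F₁), b₁.IsLoc y' μ → ∀ (y : g.Site) (x : X), N y x → |T μ x| ≤ K₀ y y' * b₁.loc y' μ)
    (hpr : ∀ (y' : g.Site) (μ : F₁), b₁.IsLoc y' μ → ∀ (y : g.Site) (x x' : X), N y x → P x x' → w x x' * |T μ x - T μ x'| ≤ K₁ y y' * b₁.loc y' μ) :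
    HasMaj b₁ (BlockNorm.ofSmoothPartition N P w hw W hW ζ Λ hΛ hsum h0 h1 hsupp hLip) T (fun y y' => W y * K₀ y y' + K₁ y y') := by
  intro y' μ hμ y
  rw [ofSmoothPartition_loc, add_mul]
  have hl0 : 0 ≤ b₁.loc y' μ := b₁.loc_nonneg _ _
  refine add_le_add ?_ ?_
  · rw [mul_assoc]
    exact mul_le_mul_of_nonneg_left (ofSup_sz_le _ (mul_nonneg (hK₀ _ _) hl0) fun x hx => hpt y' μ hμ y x hx) (hW y)
  · exact ofPairs_sz_le _ _ _ _ (mul_nonneg (hK₁ _ _) hl0) fun x x' hx hP => hpr y' μ hμ y x x' hx hP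

/-- **A MAJORANT OUT OF THE SMOOTH-PARTITION CLASS** reads exactly print's input side: inputs `λ` vanishing off `N y′`, sized by `W(y′)·sup_{N y′}|λ| + ‖λ‖` (the
jump-free pair part) — the definition unfolded. [cite: Balaban1985BackgroundPropagators, (3.44)–(3.45) p.398 («supp λ ⊂ Δ(y′) … (‖λ‖ + |λ|)»); Balaban1984PropagatorsII, (2.51) p.232] -/
theorem hasMaj_from_ofSmoothPartition_iff {b₂ : BlockNorm g F₂} {T : (X → ℝ) →ₗ[ℝ] F₂} {K : g.Site → g.Site → ℝ} :
    HasMaj (BlockNorm.ofSmoothPartition N P w hw W hW ζ Λ hΛ hsum h0 h1 hsupp hLip) b₂ T K ↔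
      ∀ (y' : g.Site) (lam : X → ℝ), (∀ x, ¬ N y' x → lam x = 0) → ∀ y : g.Site,
        b₂.loc y (T lam) ≤ K y y' * (W y' * (Size.ofSup g (fun x y => N y x)).sz y' lam + (Size.ofPairs g (fun x y => N y x) P w hw).sz y' lam) :=
  Iff.rfl

end Construction

end Literature.MathematicalPhysics.QuantumFieldTheory.Balaban1983to89.B11SectGSmoothCut
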